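import Summits.HodgeConjecture.HodgeConjecture.Theorems.TropicalKugaSatakeCayleyCayleyHodgeRankTwoPeriodStructure
import Summits.HodgeConjecture.HodgeConjecture.Theorems.TropicalKugaSatakeCayleyCayleyHodgeRankTwoDerivationCalculus
import Mathlib

/-!
# Route `TropicalKugaSatakeCayley`, crux K2 `KontsevichTransferKS` (stmt-HodgeConjecture-18570), line `birth`:
# the VERY GENERAL member of the Kuga–Satake family is Hodge-generic for rational constant forms — part 1:
# the cleared complex structure and the type criterion

The load-bearing stub `stub_kontsevichShadow` of the skeleton
`Cruxes/KontsevichTransferKS/Lines/birth.lean` asks for a point `z` of the tube domain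
`T = {z ∈ ℂ⁵ | Im z ∈ ksPosCone}` with two properties; its clause (i), HODGE-GENERICITY, is "the
constant form of every algebraic class of every model of `ℂ⁸/(ℤ⁸ ⊕ τ(z)ℤ⁸)` is a flat Hodge form"
(of type `(6,6)` on EVERY member, through every Kuga–Satake period map). This part and part 2
(`…KontsevichTransferKSGenericMemberForms`) prove the form-level heart of clause (i), for all degrees
at once (the main theorem is in part 2):

* `kontsevichTransferKS_exists_genericMember_forms` — **in every open subset of `ℂ⁵` meeting `T`
  there is `z₀ ∈ T` such that every constant alternating form `ω` on `Λ_ℝ = ℝ⁸ ⊕ ℝ⁸` of degree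
  `k = 2p` with RATIONAL values on the standard basis tuples which is of type `(p,p)` through a
  Kuga–Satake period map of `z₀` is of type `(p,p)` through every Kuga–Satake period map of every
  point of `T`** (very general members are Hodge-generic: Lange–Birkenhake §17.1; the Hodge-generic
  classes of this family are van Geemen–Verra's flat classes, §6.1).

Mechanism (no Mumford–Tate groups needed):
* §1 the complex structure `J_z = Φ⁻¹ ∘ i ∘ Φ` of the member `z` (`tkc_J_apply`) has its
  denominator cleared by the scalar `D(Im z) = a² − q` of the Clifford inverse formula
  `B_t⁻¹ = D(t)⁻¹ (a·1 − X) B₁⁻¹` (`tkc_ksMatrix_inv`): `J_z = D⁻¹ N_z` with `N_z w` POLYNOMIAL in the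
  ten real coordinates of `z` (`kgmJnum`, `kgm_J_eq`);
* §2 type `(p,p)` through `Φ` ⟺ the cleared derivation `F_ω(z; w) = Σₘ ω(…, N_z wₘ, …)` vanishes for
  all `w` (rotation invariance differentiates to `D_J ω = 0`, `ktks_sum_update_eq_zero_of_rotation`,
  and integrates back, `tkc_rotation_of_deriv_zero`) (`kgm_isConstOfType_iff`);
* §3 `F_ω(z; ·)` is multilinear, so basis tuples suffice (`Module.Basis.ext_multilinear`);
* §4 `z ↦ F_ω(z; w)` is real-analytic on `ℂ⁵` (sums and products of coordinates);
* §5 for the countably many pairs (rational `ω`, basis tuple) the set where "`F` vanishes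
  identically or `F(z) ≠ 0`" is open and dense (identity principle for real-analytic functions on
  the connected `ℂ⁵`), so their intersection is dense (Baire);
* §6 at such a `z₀ ∈ T`, type `(p,p)` forces every `F_ω(·; e_b)` to vanish at `z₀`, hence
  identically, hence type `(p,p)` everywhere.

THIS PART: §1–§3. Definitions introduced (bookkeeping only, all explicit): `kgmDen`, `kgmInvNum`,
`kgmJnum`, `kgmDeriv`, `kgmDerivML`. No named fact, no sorry.
What is NOT here: the passage from classes on a model `X` to constant forms (the Hodge-model
comparison `constFormEquiv` of the skeleton) — clause (i) proper — and clause (ii) (shadows).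

## References

* [vanGeemenVerra2003QuaternionicPryms] B. van Geemen, A. Verra, Quaternionic Pryms and Hodge classes,
  Topology 42 (2003), §6.1, Rem. 6.6.
* [LangeBirkenhake1992] H. Lange, Ch. Birkenhake, Complex Abelian Varieties (1992), §1.1.5, §8.1,
  §17.1.
* [BochnakCosteRoy1998] J. Bochnak, M. Coste, M.-F. Roy, Real Algebraic Geometry (1998), §2.8 (zero
  sets of polynomials are thin).
-/

noncomputable section

set_option linter.dupNamespace false

namespace Summit.HodgeConjecture.HodgeConjecture.Theorems

open Literature.AlgebraicGeometry.Tropical Literature.AlgebraicGeometry.Tropical.TropicalTorus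
open Literature.Geometry.Kaehler
open scoped Matrix

/-! ### §1 The complex structure of a member with its denominator cleared -/

/-- The scalar denominator `D(t) = a² − q` of the inverse formula `B_t⁻¹ = D(t)⁻¹ · (a·1 − X) B₁⁻¹`
(`a = t₀ + 2Σ t_{l+1}`, `q = Σ w_l t_{l+1}²`); non-zero on the positive cone. [folklore] -/
def kgmDen (t : Fin 5 → ℝ) : ℝ :=
  (t 0 + 2 * ∑ l : Fin 4, t l.succ) ^ 2 - ∑ l : Fin 4, (if l = 0 then (1 : ℝ) else 2) * t l.succ ^ 2

/-- The numerator `M(t) = (a·1 − X) B₁⁻¹` of the inverse formula `B_t⁻¹ = D(t)⁻¹ · M(t)`, a matrix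
whose entries are polynomial (of degree `1`) in `t`. [folklore] -/
def kgmInvNum (t : Fin 5 → ℝ) : Matrix (Fin 8) (Fin 8) ℝ :=
  ((t 0 + 2 * ∑ l : Fin 4, t l.succ) • (1 : Matrix (Fin 8) (Fin 8) ℝ) -
      ∑ l : Fin 4, t l.succ • (ksClifford l).map (Int.cast : ℤ → ℝ)) *
    Matrix.diagonal fun i : Fin 8 => ((((![2, 4, 4, 8, 4, 8, 8, 16] : Fin 8 → ℤ) i : ℝ))⁻¹)

/-- `D(t) ≠ 0` on the positive cone. [folklore] -/
theorem kgmDen_ne_zero {t : Fin 5 → ℝ} (ht : t ∈ ksPosCone) : kgmDen t ≠ 0 :=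
  tkc_sq_sub_q_ne_zero t ht

/-- `B_t⁻¹ = D(t)⁻¹ • M(t)` on the positive cone. [folklore] -/
theorem kgm_ksMatrix_inv {t : Fin 5 → ℝ} (ht : t ∈ ksPosCone) :
    (ksMatrix t)⁻¹ = (kgmDen t)⁻¹ • kgmInvNum t :=
  tkc_ksMatrix_inv t ht

/-- **The complex structure of the member `z` with its denominator cleared**:
`N_z(x, y) = (−D S y − R M (x + R y), M (x + R y))` (`R = B_(Re z)`, `S = B_(Im z)`,
`D = D(Im z)`, `M = M(Im z)`), so that `J_z = D⁻¹ N_z`; every coordinate of `N_z w` is a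
polynomial in the ten real coordinates of `z`. [cite: LangeBirkenhake1992, §1.1 and §8.1] -/
def kgmJnum (z : Fin 5 → ℂ) (w : Fin 8 ⊕ Fin 8 → ℝ) : Fin 8 ⊕ Fin 8 → ℝ :=
  Sum.elim
    (-(kgmDen (fun k => (z k).im) • (ksMatrix (fun k => (z k).im) *ᵥ fun j => w (Sum.inr j))) -
      ksMatrix (fun k => (z k).re) *ᵥ (kgmInvNum (fun k => (z k).im) *ᵥ
        ((fun i => w (Sum.inl i)) + ksMatrix (fun k => (z k).re) *ᵥ fun j => w (Sum.inr j))))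
    (kgmInvNum (fun k => (z k).im) *ᵥ
      ((fun i => w (Sum.inl i)) + ksMatrix (fun k => (z k).re) *ᵥ fun j => w (Sum.inr j)))

/-- `J_z = D(Im z)⁻¹ • N_z` for every Kuga–Satake period map of a point of the tube domain.
[cite: LangeBirkenhake1992, §1.1 and §8.1] -/
theorem kgm_J_eq {z : Fin 5 → ℂ} {Φ : (Fin 8 ⊕ Fin 8 → ℝ) ≃L[ℝ] (Fin 8 → ℂ)}
    (hΦ : IsKSPeriodMap z Φ) (hz : (fun k => (z k).im) ∈ ksPosCone) (w : Fin 8 ⊕ Fin 8 → ℝ) :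
    Φ.symm (Complex.I • Φ w) = (kgmDen (fun k => (z k).im))⁻¹ • kgmJnum z w := by
  have hD := kgmDen_ne_zero hz
  rw [tkc_J_apply hΦ hz w, kgm_ksMatrix_inv hz]
  simp only [kgmJnum, Matrix.smul_mulVec, Matrix.mulVec_smul]
  funext i
  rcases i with i | i
  · simp only [Pi.smul_apply, Sum.elim_inl, Pi.sub_apply, Pi.neg_apply, smul_eq_mul]
    field_simp
  · simp only [Pi.smul_apply, Sum.elim_inr]

/-- **The cleared derivation** `F_ω(z; w) = Σₘ ω(w₁, …, N_z wₘ, …, w_k)` of a constant form along the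
cleared complex structure — for fixed `ω, w` a polynomial function of `z`. [folklore] -/
def kgmDeriv {k : ℕ} (ω : (Fin 8 ⊕ Fin 8 → ℝ) [⋀^Fin k]→L[ℝ] ℂ) (z : Fin 5 → ℂ)
    (w : Fin k → (Fin 8 ⊕ Fin 8 → ℝ)) : ℂ :=
  ∑ m, ω (Function.update w m (kgmJnum z (w m)))

/-- `Σₘ ω(…, J_z wₘ, …) = D⁻¹ • F_ω(z; w)`: the true derivation along `J_z` is the cleared one divided
by the denominator. [folklore] -/
theorem kgm_sum_update_J_eq {k : ℕ} (ω : (Fin 8 ⊕ Fin 8 → ℝ) [⋀^Fin k]→L[ℝ] ℂ)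
    {z : Fin 5 → ℂ} {Φ : (Fin 8 ⊕ Fin 8 → ℝ) ≃L[ℝ] (Fin 8 → ℂ)}
    (hΦ : IsKSPeriodMap z Φ) (hz : (fun k => (z k).im) ∈ ksPosCone) (w : Fin k → (Fin 8 ⊕ Fin 8 → ℝ)) :
    ∑ m, ω (Function.update w m (Φ.symm (Complex.I • Φ (w m)))) =
      ((kgmDen (fun k => (z k).im))⁻¹ : ℝ) • kgmDeriv ω z w := by
  classical
  simp only [kgmDeriv, Finset.smul_sum, kgm_J_eq hΦ hz, ContinuousAlternatingMap.map_update_smul]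

/-! ### §2 Type `(p,p)` through a period map ⟺ the cleared derivation vanishes -/

/-- **Hodge type through the period map is the vanishing of the cleared derivation.** For a point `z`
of the tube domain, a Kuga–Satake period map `Φ` of `z` and a constant alternating `k`-form `ω` on
`Λ_ℝ` (`k = p + p`): `ω ∘ Φ⁻¹` is of type `(p,p)` on `ℂ⁸` iff `F_ω(z; w) = 0` for all `w`
(rotation invariance differentiates to `D_(J_z) ω = 0` and integrates back, `J_z² = −1`;
`J_z = D⁻¹ N_z` with `D ≠ 0`). [cite: LangeBirkenhake1992, §1.1.5] -/
theorem kgm_isConstOfType_iff {k p : ℕ} (hk : p + p = k) (ω : (Fin 8 ⊕ Fin 8 → ℝ) [⋀^Fin k]→L[ℝ] ℂ)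
    {z : Fin 5 → ℂ} {Φ : (Fin 8 ⊕ Fin 8 → ℝ) ≃L[ℝ] (Fin 8 → ℂ)}
    (hΦ : IsKSPeriodMap z Φ) (hz : (fun k => (z k).im) ∈ ksPosCone) :
    ComplexTorus.IsConstOfType p p
        (ω.compContinuousLinearMap (Φ.symm : (Fin 8 → ℂ) →L[ℝ] (Fin 8 ⊕ Fin 8 → ℝ))) ↔
      ∀ w : Fin k → (Fin 8 ⊕ Fin 8 → ℝ), kgmDeriv ω z w = 0 := by
  classical
  have hD := kgmDen_ne_zero hz
  -- the complex structure `J = Φ⁻¹ ∘ i ∘ Φ` as a real continuous linear map, `J² = -1`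
  let Jc : (Fin 8 ⊕ Fin 8 → ℝ) →L[ℝ] (Fin 8 ⊕ Fin 8 → ℝ) :=
    ((Φ.symm : (Fin 8 → ℂ) →L[ℝ] (Fin 8 ⊕ Fin 8 → ℝ)).comp
      (((Complex.I • ContinuousLinearMap.id ℂ (Fin 8 → ℂ)).restrictScalars ℝ).comp
        (Φ : (Fin 8 ⊕ Fin 8 → ℝ) →L[ℝ] (Fin 8 → ℂ))))
  have hJc : ∀ w, Jc w = Φ.symm (Complex.I • Φ w) := fun w => rfl
  have hJ2 : ∀ w, Jc (Jc w) = -w := by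
    intro w
    rw [hJc, hJc, ContinuousLinearEquiv.apply_symm_apply, smul_smul, Complex.I_mul_I, neg_one_smul,
      map_neg, ContinuousLinearEquiv.symm_apply_apply]
  have hexp1 : ∀ θ : ℝ, Complex.exp ((((p : ℤ) - p : ℤ) : ℂ) * θ * Complex.I) = 1 := by
    intro θ
    simp
  constructor
  · -- type ⇒ rotation invariance ⇒ derivation zero
    rintro ⟨-, hrot⟩ w
    have hrot' : ∀ (θ : ℝ) (w : Fin k → (Fin 8 ⊕ Fin 8 → ℝ)),
        ω (fun i => Real.cos θ • w i + Real.sin θ • Jc (w i)) = ω w := by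
      intro θ w
      have h := hrot θ (fun i => Φ (w i))
      rw [hexp1, one_mul] at h
      simp only [ContinuousAlternatingMap.compContinuousLinearMap_apply, Function.comp_def,
        ContinuousLinearEquiv.coe_coe, ContinuousLinearEquiv.symm_apply_apply] at h
      simpa only [hJc, tkc_symm_exp_smul_eq] using h
    have h0 := ktks_sum_update_eq_zero_of_rotation ω Jc hrot' w
    simp only [hJc] at h0
    rw [kgm_sum_update_J_eq ω hΦ hz w] at h0
    have hD' : ((kgmDen (fun k => (z k).im))⁻¹ : ℝ) ≠ 0 := inv_ne_zero hD
    exact (smul_eq_zero.1 h0).resolve_left hD'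
  · -- derivation zero ⇒ rotation invariance ⇒ type
    intro h
    refine ⟨hk, fun θ v => ?_⟩
    rw [hexp1, one_mul]
    have hderiv : ∀ w : Fin k → (Fin 8 ⊕ Fin 8 → ℝ), ∑ m, ω (Function.update w m (Jc (w m))) = 0 := by
      intro w
      simp only [hJc]
      rw [kgm_sum_update_J_eq ω hΦ hz w, h w, smul_zero]
    have hrot := tkc_rotation_of_deriv_zero ω Jc hJ2 hderiv θ (fun i => Φ.symm (v i))
    simp only [ContinuousAlternatingMap.compContinuousLinearMap_apply, Function.comp_def,
      ContinuousLinearEquiv.coe_coe]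
    have hv : ∀ i, Φ.symm (Complex.exp (θ * Complex.I) • v i) =
        Real.cos θ • Φ.symm (v i) + Real.sin θ • Jc (Φ.symm (v i)) := by
      intro i
      have h1 := tkc_symm_exp_smul_eq Φ θ (Φ.symm (v i))
      rw [ContinuousLinearEquiv.apply_symm_apply] at h1
      rw [hJc, ContinuousLinearEquiv.apply_symm_apply]
      exact h1
    simp only [hv]
    exact hrot

/-! ### §3 Multilinearity in `w`: basis tuples suffice -/

/-- The cleared derivation as a multilinear map in `w`. [folklore] -/
def kgmDerivML {k : ℕ} (ω : (Fin 8 ⊕ Fin 8 → ℝ) [⋀^Fin k]→L[ℝ] ℂ) {z : Fin 5 → ℂ}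
    {Φ : (Fin 8 ⊕ Fin 8 → ℝ) ≃L[ℝ] (Fin 8 → ℂ)} (_hΦ : IsKSPeriodMap z Φ) :
    MultilinearMap ℝ (fun _ : Fin k => (Fin 8 ⊕ Fin 8 → ℝ)) ℂ := by
  classical
  exact ∑ m : Fin k, ω.toContinuousMultilinearMap.toMultilinearMap.compLinearMap
    (Function.update (fun _ => LinearMap.id)
      m (((kgmDen (fun k => (z k).im)) : ℝ) • (((Φ.symm : (Fin 8 → ℂ) →L[ℝ] (Fin 8 ⊕ Fin 8 → ℝ)).comp
      (((Complex.I • ContinuousLinearMap.id ℂ (Fin 8 → ℂ)).restrictScalars ℝ).comp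
        (Φ : (Fin 8 ⊕ Fin 8 → ℝ) →L[ℝ] (Fin 8 → ℂ)))) : (Fin 8 ⊕ Fin 8 → ℝ) →ₗ[ℝ] (Fin 8 ⊕ Fin 8 → ℝ))))

/-- The multilinear map evaluates to the cleared derivation. [folklore] -/
theorem kgmDerivML_apply {k : ℕ} (ω : (Fin 8 ⊕ Fin 8 → ℝ) [⋀^Fin k]→L[ℝ] ℂ) {z : Fin 5 → ℂ}
    {Φ : (Fin 8 ⊕ Fin 8 → ℝ) ≃L[ℝ] (Fin 8 → ℂ)} (hΦ : IsKSPeriodMap z Φ)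
    (hz : (fun k => (z k).im) ∈ ksPosCone) (w : Fin k → (Fin 8 ⊕ Fin 8 → ℝ)) :
    kgmDerivML ω hΦ w = kgmDeriv ω z w := by
  classical
  have hD := kgmDen_ne_zero hz
  simp only [kgmDerivML, sum_apply, MultilinearMap.compLinearMap_apply, kgmDeriv]
  refine Finset.sum_congr rfl fun m _ => ?_
  have hfun : (fun i => (Function.update (fun _ : Fin k => (LinearMap.id :
        (Fin 8 ⊕ Fin 8 → ℝ) →ₗ[ℝ] (Fin 8 ⊕ Fin 8 → ℝ))) m
      (((kgmDen (fun k => (z k).im)) : ℝ) • (((Φ.symm : (Fin 8 → ℂ) →L[ℝ] (Fin 8 ⊕ Fin 8 → ℝ)).comp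
      (((Complex.I • ContinuousLinearMap.id ℂ (Fin 8 → ℂ)).restrictScalars ℝ).comp
        (Φ : (Fin 8 ⊕ Fin 8 → ℝ) →L[ℝ] (Fin 8 → ℂ)))) :
          (Fin 8 ⊕ Fin 8 → ℝ) →ₗ[ℝ] (Fin 8 ⊕ Fin 8 → ℝ))) i) (w i)) =
      Function.update w m (kgmJnum z (w m)) := by
    funext i
    by_cases him : i = m
    · subst him
      simp only [Function.update_self, LinearMap.smul_apply, ContinuousLinearMap.coe_coe,
        ContinuousLinearMap.coe_comp, ContinuousLinearEquiv.coe_coe, Function.comp_apply,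
        ContinuousLinearMap.coe_restrictScalars', FunLike.coe_smul,
        ContinuousLinearMap.coe_id', Pi.smul_apply, id_eq]
      rw [kgm_J_eq hΦ hz, smul_smul, mul_inv_cancel₀ hD, one_smul]
    · simp only [Function.update_of_ne him, LinearMap.id_apply]
  rw [hfun]
  rfl

/-- **Basis tuples suffice**: if the cleared derivation vanishes on all tuples of standard basis
vectors, it vanishes identically (it is multilinear in `w`). [folklore] -/
theorem kgmDeriv_eq_zero_of_basis {k : ℕ} (ω : (Fin 8 ⊕ Fin 8 → ℝ) [⋀^Fin k]→L[ℝ] ℂ)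
    {z : Fin 5 → ℂ} {Φ : (Fin 8 ⊕ Fin 8 → ℝ) ≃L[ℝ] (Fin 8 → ℂ)} (hΦ : IsKSPeriodMap z Φ)
    (hz : (fun k => (z k).im) ∈ ksPosCone)
    (h : ∀ b : Fin k → Fin 8 ⊕ Fin 8, kgmDeriv ω z (fun m => Pi.single (b m) (1 : ℝ)) = 0) :
    ∀ w, kgmDeriv ω z w = 0 := by
  classical
  have hML : kgmDerivML ω hΦ = 0 := by
    refine Module.Basis.ext_multilinear (fun _ => Pi.basisFun ℝ (Fin 8 ⊕ Fin 8)) fun b => ?_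
    rw [zero_apply]
    simp only [Pi.basisFun_apply]
    rw [kgmDerivML_apply ω hΦ hz]
    exact h b
  intro w
  rw [← kgmDerivML_apply ω hΦ hz w, hML, zero_apply]

end Summit.HodgeConjecture.HodgeConjecture.Theorems

end
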